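import Literature.Geometry.Lorentzian.ConvergenceTransport
import Literature.Topology.FourManifolds.GluedMetric
import Literature.Geometry.Manifold.OpenSubmanifoldTangent
import Mathlib.Geometry.Manifold.PartitionOfUnity
import Mathlib.Geometry.Manifold.VectorField.Pullback
import HarnessLib

/-!
# Time orientations descend to an open gluing of time-oriented Lorentzian manifolds
# (Sbierski 2016, §3.3, proof of Thm. 5: "`(M̃, g̃)` has a natural time orientation")

Let `P = A ∪_ψ B` be the open gluing of two boundaryless manifolds along a partial diffeomorphism
(`Literature.Topology.FourManifolds.SmoothGlueData.Glued`, Kosinski VI.1) and let `g̃` be a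
Lorentzian metric on `P` for which the pieces `inl : A → P`, `inr : B → P` are isometric
immersions of time-oriented Lorentzian manifolds `(A, g_A, T_A)`, `(B, g_B, T_B)` (the metric of
`SmoothGlueData.exists_metric_of_glue_isometry`, `GluedMetric.lean`). If on the gluing region the
pushed-forward orienting vectors `d(inl) T_A` and `d(inr) T_B` lie in the same timecone, then
`(P, g̃)` carries a time orientation for which `inl` and `inr` preserve the time orientation
(`SmoothGlueData.exists_timeOrientation_of_glue`). This is the time-orientation step in
J. Sbierski, Ann. Henri Poincaré 17 (2016) = arXiv:1309.7591v3, §3.3, proof of Thm. 5: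

> *"Since `M` and `M'` are time oriented, there exist continuous timelike vector fields `T` on `M`
> and `T'` on `M'`. Since `ψ : U → M'` preserves the time orientation, at each point `ψ_*(T|_U)`
> and `T'|_{ψ(U)}` lie in the same component of the set of all timelike tangent vectors at this
> point. Thus, pushing forward `T` and `T'` via `π ∘ j` and `π ∘ j'` we can consistently single out
> a future direction at each point of `M̃`. It remains to show that this choice is continuous. But
> since this is a local property, this follows immediately from `(π ∘ j)_*(T)` and `(π ∘ j')_*(T')`
> being continuous."*

The tree's time orientations are smooth timelike vector FIELDS (`TimeOrientation`; O'Neill 1983,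
Ch. 5, Lemma 5.32: a continuous choice of timecones on a manifold comes from a timelike vector
field, by a partition of unity, timecones being convex). Accordingly the consistent choice of
future timecones `t p = {v timelike | g̃(R p, v) < 0}` (`R p` the pushed-forward orienting vector
of the piece through `p`) is shown to be a convex-valued family
(`LorentzianMetric.convex_timecone`) with smooth local sections — the pushed-forward fields
themselves (`exists_contMDiffOn_pushforward_inl`: the push-forward along the diffeomorphism `A ≅ inl(A)` is
Mathlib's `VectorField.mpullback` along its inverse, a smooth field on the open submanifold
`inl(A)`, hence smooth on `P` there, `OpenSubmanifold.contMDiffAt_tangentSection_of_restrict`) —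
so that Mathlib's `exists_contMDiffSection_forall_mem_convex_of_local` (partition of unity on the
σ-compact Hausdorff `P`) produces a smooth timelike field in these cones.

Also: `SmoothGlueData.isOpenMap_proj`, `SmoothGlueData.secondCountableTopology_of_pieces` (an open
gluing of second countable pieces is second countable). The results about the glued space are
deliberate dot-notation extensions of the structure `Literature.Topology.FourManifolds.SmoothGlueData`
(declared with their absolute names, CONVENTIONS §2); the pointwise lemmas live in
`Literature.Geometry.Lorentzian`. Everything is proved; no definitions and no named facts are
introduced (D-0026).

## References

* J. Sbierski, Ann. Henri Poincaré 17 (2016) 301–329 = arXiv:1309.7591v3, §3.3, proof of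
  Thm. 5 (time orientation step, p. 18 of the arXiv version).
* B. O'Neill, *Semi-Riemannian geometry with applications to relativity*, 1983, Ch. 5,
  Lemma 5.29 (convex timecones), Lemma 5.32 and p. 145 (time orientability).
-/

noncomputable section

open Bundle Set Function Filter TopologicalSpace Topology Manifold VectorField
open scoped Manifold ContDiff Topology

namespace Literature.Geometry.Lorentzian

/-! ### A vector field smooth on an open submanifold is smooth there -/

namespace OpenSubmanifold

open Literature.Geometry.Manifold.OpenSubmanifold

variable {E : Type*} [NormedAddCommGroup E] [NormedSpace ℝ E] {H : Type*} [TopologicalSpace H]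
  {I : ModelWithCorners ℝ E H} {X : Type*} [TopologicalSpace X] [ChartedSpace H X]
  [IsManifold I ∞ X]

/-- **Smoothness of a vector field is local on open submanifolds** (converse of
`contMDiff_tangentSection`, pointwise): if `x₀ ∈ U` and `x ↦ V ↑x` is `C^n` at `x₀` as a section
of `TU` over the open submanifold `U`, then `V` is `C^n` at `x₀` as a section of `TX` (the
trivialisations of `TU` are those of `TX`, `continuousLinearMapAt_trivializationAt_eq`, and
`ContMDiffAt` on `U` versus `X` is `contMDiffAt_subtype_iff`). O'Neill 1983, Ch. 2, pp. 36–37.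
[cite: ONeillSemiRiemannian1983, Ch. 2, pp. 36–37] -/
theorem contMDiffAt_tangentSection_of_restrict {n : ℕ∞ω} {V : Π x : X, TangentSpace I x}
    (U : Opens X) (x₀ : U)
    (hV : ContMDiffAt I I.tangent n
      (fun x : U ↦ (TotalSpace.mk' E x (V x.1) : TangentBundle I U)) x₀) :
    ContMDiffAt I I.tangent n (fun x : X ↦ (TotalSpace.mk' E x (V x) : TangentBundle I X)) x₀.1 := by
  rw [contMDiffAt_section] at hV ⊢
  rw [← contMDiffAt_subtype_iff (U := U)]
  refine hV.congr_of_eventuallyEq ?_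
  have hnhds : ∀ᶠ x : U in 𝓝 x₀, x.1 ∈ (chartAt H x₀.1).source :=
    continuous_subtype_val.continuousAt.preimage_mem_nhds
      ((chartAt H x₀.1).open_source.mem_nhds (mem_chart_source H x₀.1))
  filter_upwards [hnhds] with x hx
  have hxU : x ∈ (trivializationAt E (TangentSpace I : U → Type _) x₀).baseSet := by
    simpa only [TangentBundle.trivializationAt_baseSet, Opens.chartAt_eq,
      OpenPartialHomeomorph.subtypeRestr_source, mem_preimage] using hx
  have hxX : x.1 ∈ (trivializationAt E (TangentSpace I : X → Type _) x₀.1).baseSet := by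
    simpa only [TangentBundle.trivializationAt_baseSet] using hx
  calc (trivializationAt E (TangentSpace I : X → Type _) x₀.1 ⟨x.1, V x.1⟩).2
      = (trivializationAt E (TangentSpace I : X → Type _) x₀.1).continuousLinearMapAt ℝ x.1
          (V x.1) :=
        (Trivialization.continuousLinearMapAt_apply_of_mem (R := ℝ) (e := _) (hb := hxX)
          (y := V x.1)).symm
    _ = (trivializationAt E (TangentSpace I : U → Type _) x₀).continuousLinearMapAt ℝ x (V x.1) :=
        (DFunLike.congr_fun (continuousLinearMapAt_trivializationAt_eq (I := I) hx) (V x.1)).symm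
    _ = (trivializationAt E (TangentSpace I : U → Type _) x₀ ⟨x, V x.1⟩).2 :=
        Trivialization.continuousLinearMapAt_apply_of_mem (R := ℝ) (e := _) (hb := hxU)
          (y := V x.1)

end OpenSubmanifold

/-! ### Pointwise Lorentzian algebra: convexity of a timecone -/

section Cone

variable {E : Type*} [NormedAddCommGroup E] [NormedSpace ℝ E] {H : Type*} [TopologicalSpace H]
  {I : ModelWithCorners ℝ E H} {m : ℕ∞ω} {M : Type*} [TopologicalSpace M] [ChartedSpace H M]
  [IsManifold I ∞ M]

namespace LorentzianMetric

variable (g : LorentzianMetric I m M) {x : M}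

/-- Nonzero multiples of timelike vectors are timelike. O'Neill 1983, Ch. 5, p. 143.
[cite: ONeillSemiRiemannian1983, Ch. 5, Lemma 5.29] -/
theorem isTimelike_smul {v : TangentSpace I x} (hv : g.IsTimelike v) {c : ℝ} (hc : c ≠ 0) :
    g.IsTimelike (c • v) := by
  rw [isTimelike_iff] at hv ⊢
  simp only [map_smul, FunLike.coe_smul, Pi.smul_apply, smul_eq_mul]
  have h : c * (c * g.val x v v) = c ^ 2 * g.val x v v := by ring
  rw [h]
  exact mul_neg_of_pos_of_neg (by positivity) hv

/-- **The future timecone of a timelike vector is convex**: the set of timelike `v` with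
`g(R, v) < 0` (`R` timelike) is convex — two such vectors lie in one timecone (`g(v, w) < 0`,
`val_lt_zero_of_isCausal`), and timecones are convex cones (O'Neill 1983, Ch. 5, Lemma 5.29).
[cite: ONeillSemiRiemannian1983, Ch. 5, Lemma 5.29 and p. 145] -/
theorem convex_timecone {R : TangentSpace I x} (hR : g.IsTimelike R) :
    Convex ℝ {v : TangentSpace I x | g.IsTimelike v ∧ g.val x R v < 0} := by
  intro v hv w hw a b ha hb hab
  rcases ha.eq_or_lt with rfl | ha'
  · rw [zero_add] at hab
    subst hab
    simpa using hw
  rcases hb.eq_or_lt with rfl | hb'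
  · rw [add_zero] at hab
    subst hab
    simpa using hv
  have hvw : g.val x v w < 0 := g.val_lt_zero_of_isCausal hR hv.1 hv.2 hw.1.isCausal hw.2
  have hvv : g.val x v v < 0 := hv.1
  have hww : g.val x w w < 0 := hw.1
  refine ⟨?_, ?_⟩
  · rw [isTimelike_iff]
    have hwv : g.val x w v < 0 := by rwa [g.symm]
    simp only [map_add, map_smul, _root_.add_apply, FunLike.coe_smul, Pi.smul_apply, smul_eq_mul]
    nlinarith [mul_pos ha' hb', mul_pos ha' ha', mul_pos hb' hb']
  · simp only [map_add, map_smul, smul_eq_mul]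
    nlinarith [hv.2, hw.2]

end LorentzianMetric

end Cone

/-! ### Second countability of an open gluing -/

section GlueData

open Literature.Topology.FourManifolds

universe uA uB

variable {E_A H_A E_B H_B : Type*}
  [NormedAddCommGroup E_A] [NormedSpace ℝ E_A] [TopologicalSpace H_A]
  [NormedAddCommGroup E_B] [NormedSpace ℝ E_B] [TopologicalSpace H_B]
  {I_A : ModelWithCorners ℝ E_A H_A} {I_B : ModelWithCorners ℝ E_B H_B}
  {A : Type uA} [TopologicalSpace A] [ChartedSpace H_A A]
  {B : Type uB} [TopologicalSpace B] [ChartedSpace H_B B]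
  {E_P : Type*} [NormedAddCommGroup E_P] [NormedSpace ℝ E_P]
  (d : SmoothGlueData I_A I_B A B E_P)

/-- The quotient map `A ⊔ B → A ∪_ψ B` is open (saturations of open sets are open: `inl`, `inr`
are open maps). [folklore] -/
theorem _root_.Literature.Topology.FourManifolds.SmoothGlueData.isOpenMap_proj : IsOpenMap d.proj := by
  intro s hs
  have heq : d.proj '' s = d.inl '' (Sum.inl ⁻¹' s) ∪ d.inr '' (Sum.inr ⁻¹' s) := by
    ext q
    constructor
    · rintro ⟨x | x, hx, rfl⟩
      · exact Or.inl ⟨x, hx, rfl⟩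
      · exact Or.inr ⟨x, hx, rfl⟩
    · rintro (⟨a, ha, rfl⟩ | ⟨b, hb, rfl⟩)
      · exact ⟨Sum.inl a, ha, rfl⟩
      · exact ⟨Sum.inr b, hb, rfl⟩
  rw [heq]
  obtain ⟨h₁, h₂⟩ := isOpen_sum_iff.1 hs
  exact (d.isOpenMap_inl _ h₁).union (d.isOpenMap_inr _ h₂)

/-- **An open gluing of second countable pieces is second countable** (an open quotient of the
second countable `A ⊔ B`). [folklore] -/
theorem _root_.Literature.Topology.FourManifolds.SmoothGlueData.secondCountableTopology_of_pieces
    [SecondCountableTopology A] [SecondCountableTopology B] :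
    SecondCountableTopology d.Glued :=
  d.isQuotientMap_proj.secondCountableTopology d.isOpenMap_proj

/-! ### The pushed-forward orienting fields -/

section TimeOrientation

variable [I_A.Boundaryless] [I_B.Boundaryless] [IsManifold I_A ∞ A] [IsManifold I_B ∞ B]
  {gA : LorentzianMetric I_A ∞ A} (τA : TimeOrientation gA)
  {gB : LorentzianMetric I_B ∞ B} (τB : TimeOrientation gB)

/-- The pullback of `T_A` along the inverse of a diffeomorphism `θ : A ≅ inl(A)` is the
push-forward: its value at `x` is `dθ (T_A (θ⁻¹ x))`. [folklore] -/
theorem _root_.Literature.Topology.FourManifolds.SmoothGlueData.mpullback_symm_apply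
    (θ : A ≃ₘ^∞⟮I_A, 𝓘(ℝ, E_P)⟯ (⟨range d.inl, d.isOpen_range_inl⟩ : Opens d.Glued))
    (x : (⟨range d.inl, d.isOpen_range_inl⟩ : Opens d.Glued)) :
    mpullback 𝓘(ℝ, E_P) I_A θ.symm τA.vectorField x =
      mfderiv I_A 𝓘(ℝ, E_P) θ (θ.symm x) (τA.vectorField (θ.symm x)) := by
  rw [mpullback_apply]
  have hinv : (mfderiv 𝓘(ℝ, E_P) I_A θ.symm x).IsInvertible :=
    ⟨θ.symm.mfderivToContinuousLinearEquiv (by simp) x, rfl⟩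
  refine (hinv.inverse_apply_eq).2 ?_
  have h := mfderiv_symm_apply_mfderiv θ (θ.symm x) (τA.vectorField (θ.symm x))
  rw [θ.apply_symm_apply] at h
  exact h.symm

/-- The same for the second piece. [folklore] -/
theorem _root_.Literature.Topology.FourManifolds.SmoothGlueData.mpullback_symm_apply'
    (θ : B ≃ₘ^∞⟮I_B, 𝓘(ℝ, E_P)⟯ (⟨range d.inr, d.isOpen_range_inr⟩ : Opens d.Glued))
    (x : (⟨range d.inr, d.isOpen_range_inr⟩ : Opens d.Glued)) :
    mpullback 𝓘(ℝ, E_P) I_B θ.symm τB.vectorField x =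
      mfderiv I_B 𝓘(ℝ, E_P) θ (θ.symm x) (τB.vectorField (θ.symm x)) := by
  rw [mpullback_apply]
  have hinv : (mfderiv 𝓘(ℝ, E_P) I_B θ.symm x).IsInvertible :=
    ⟨θ.symm.mfderivToContinuousLinearEquiv (by simp) x, rfl⟩
  refine (hinv.inverse_apply_eq).2 ?_
  have h := mfderiv_symm_apply_mfderiv θ (θ.symm x) (τB.vectorField (θ.symm x))
  rw [θ.apply_symm_apply] at h
  exact h.symm

/-- **The push-forward of the orienting field of `A` is a smooth vector field of the glued space
on `inl(A)`**: extended by zero off `inl(A)`, the field `p ↦ d(inl)(T_A(inl⁻¹ p))` — realised as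
the pullback of `T_A` along the inverse of the diffeomorphism `θ : A ≅ inl(A)`
(`exists_diffeomorph_inl`) — is `C^∞` on `inl(A)` as a section of the tangent bundle of `A ∪_ψ B`
(`ContMDiff.mpullback_vectorField` on the open submanifold `inl(A)`, then
`OpenSubmanifold.contMDiffAt_tangentSection_of_restrict`), and its value at `inl a` is
`d(inl)_a T_A(a)`. *"since this is a local property, this follows immediately from `(π ∘ j)_*(T)`
… being continuous"* (Sbierski 2016, §3.3; here: smooth). [cite: Sbierski2016AHP, §3.3, proof of Thm. 5 (time orientation step)] -/
theorem _root_.Literature.Topology.FourManifolds.SmoothGlueData.exists_contMDiffOn_pushforward_inl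
    [FiniteDimensional ℝ E_P] :
    ∃ s : Π p : d.Glued, TangentSpace 𝓘(ℝ, E_P) p,
      ContMDiffOn 𝓘(ℝ, E_P) 𝓘(ℝ, E_P).tangent ∞
        (fun p ↦ (TotalSpace.mk' E_P p (s p) : TangentBundle 𝓘(ℝ, E_P) d.Glued)) (range d.inl) ∧
      ∀ a, s (d.inl a) = mfderiv I_A 𝓘(ℝ, E_P) d.inl a (τA.vectorField a) := by
  classical
  haveI : CompleteSpace E_P := FiniteDimensional.complete ℝ E_P
  obtain ⟨θ, hθ⟩ := d.exists_diffeomorph_inl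
  -- the push-forward on the open submanifold `inl(A)`
  have hY : ContMDiff 𝓘(ℝ, E_P) 𝓘(ℝ, E_P).tangent ∞
      (fun x : (⟨range d.inl, d.isOpen_range_inl⟩ : Opens d.Glued) ↦
        (TotalSpace.mk' E_P x (mpullback 𝓘(ℝ, E_P) I_A θ.symm τA.vectorField x) :
          TangentBundle 𝓘(ℝ, E_P) (⟨range d.inl, d.isOpen_range_inl⟩ : Opens d.Glued))) :=
    ContMDiff.mpullback_vectorField (m := ∞) (n := ∞) τA.contMDiff θ.symm.contMDiff
      (fun x ↦ ⟨θ.symm.mfderivToContinuousLinearEquiv (by simp) x, rfl⟩) le_rfl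
  -- extended by zero
  let s : Π p : d.Glued, TangentSpace 𝓘(ℝ, E_P) p := fun p ↦
    if h : p ∈ range d.inl then mpullback 𝓘(ℝ, E_P) I_A θ.symm τA.vectorField
      (⟨p, h⟩ : (⟨range d.inl, d.isOpen_range_inl⟩ : Opens d.Glued)) else 0
  refine ⟨s, fun p hp ↦ ?_, fun a ↦ ?_⟩
  · have hrestr : ContMDiffAt 𝓘(ℝ, E_P) 𝓘(ℝ, E_P).tangent ∞
        (fun x : (⟨range d.inl, d.isOpen_range_inl⟩ : Opens d.Glued) ↦
          (TotalSpace.mk' E_P x (s x.1) :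
            TangentBundle 𝓘(ℝ, E_P) (⟨range d.inl, d.isOpen_range_inl⟩ : Opens d.Glued)))
        ⟨p, hp⟩ := by
      have heq : (fun x : (⟨range d.inl, d.isOpen_range_inl⟩ : Opens d.Glued) ↦
          (TotalSpace.mk' E_P x (s x.1) :
            TangentBundle 𝓘(ℝ, E_P) (⟨range d.inl, d.isOpen_range_inl⟩ : Opens d.Glued))) =
          fun x ↦ (TotalSpace.mk' E_P x (mpullback 𝓘(ℝ, E_P) I_A θ.symm τA.vectorField x) :
            TangentBundle 𝓘(ℝ, E_P) (⟨range d.inl, d.isOpen_range_inl⟩ : Opens d.Glued)) := by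
        funext x
        have hx : (x : d.Glued) ∈ range d.inl := x.2
        simp only [s, dif_pos hx]
      rw [heq]
      exact hY ⟨p, hp⟩
    exact (OpenSubmanifold.contMDiffAt_tangentSection_of_restrict _ ⟨p, hp⟩ hrestr).contMDiffWithinAt
  · have h : d.inl a ∈ range d.inl := ⟨a, rfl⟩
    have hx : (⟨d.inl a, h⟩ : (⟨range d.inl, d.isOpen_range_inl⟩ : Opens d.Glued)) = θ a :=
      Subtype.ext (hθ a).symm
    simp only [s, dif_pos h]
    rw [hx, d.mpullback_symm_apply τA θ (θ a)]
    have hgen : ∀ a', a' = a → mfderiv I_A 𝓘(ℝ, E_P) θ a' (τA.vectorField a') =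
        mfderiv I_A 𝓘(ℝ, E_P) d.inl a (τA.vectorField a) := by
      intro a' ha'
      subst a'
      exact (d.mfderiv_inl_eq_of_diffeomorph θ hθ a _).symm
    exact hgen _ (θ.symm_apply_apply a)

/-- **The push-forward of the orienting field of `B` is a smooth vector field of the glued space
on `inr(B)`**, with value `d(inr)_b T_B(b)` at `inr b`. [cite: Sbierski2016AHP, §3.3, proof of Thm. 5 (time orientation step)] -/
theorem _root_.Literature.Topology.FourManifolds.SmoothGlueData.exists_contMDiffOn_pushforward_inr
    [FiniteDimensional ℝ E_P] :
    ∃ s : Π p : d.Glued, TangentSpace 𝓘(ℝ, E_P) p,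
      ContMDiffOn 𝓘(ℝ, E_P) 𝓘(ℝ, E_P).tangent ∞
        (fun p ↦ (TotalSpace.mk' E_P p (s p) : TangentBundle 𝓘(ℝ, E_P) d.Glued)) (range d.inr) ∧
      ∀ b, s (d.inr b) = mfderiv I_B 𝓘(ℝ, E_P) d.inr b (τB.vectorField b) := by
  classical
  haveI : CompleteSpace E_P := FiniteDimensional.complete ℝ E_P
  obtain ⟨θ, hθ⟩ := d.exists_diffeomorph_inr
  have hY : ContMDiff 𝓘(ℝ, E_P) 𝓘(ℝ, E_P).tangent ∞
      (fun x : (⟨range d.inr, d.isOpen_range_inr⟩ : Opens d.Glued) ↦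
        (TotalSpace.mk' E_P x (mpullback 𝓘(ℝ, E_P) I_B θ.symm τB.vectorField x) :
          TangentBundle 𝓘(ℝ, E_P) (⟨range d.inr, d.isOpen_range_inr⟩ : Opens d.Glued))) :=
    ContMDiff.mpullback_vectorField (m := ∞) (n := ∞) τB.contMDiff θ.symm.contMDiff
      (fun x ↦ ⟨θ.symm.mfderivToContinuousLinearEquiv (by simp) x, rfl⟩) le_rfl
  let s : Π p : d.Glued, TangentSpace 𝓘(ℝ, E_P) p := fun p ↦
    if h : p ∈ range d.inr then mpullback 𝓘(ℝ, E_P) I_B θ.symm τB.vectorField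
      (⟨p, h⟩ : (⟨range d.inr, d.isOpen_range_inr⟩ : Opens d.Glued)) else 0
  refine ⟨s, fun p hp ↦ ?_, fun b ↦ ?_⟩
  · have hrestr : ContMDiffAt 𝓘(ℝ, E_P) 𝓘(ℝ, E_P).tangent ∞
        (fun x : (⟨range d.inr, d.isOpen_range_inr⟩ : Opens d.Glued) ↦
          (TotalSpace.mk' E_P x (s x.1) :
            TangentBundle 𝓘(ℝ, E_P) (⟨range d.inr, d.isOpen_range_inr⟩ : Opens d.Glued)))
        ⟨p, hp⟩ := by
      have heq : (fun x : (⟨range d.inr, d.isOpen_range_inr⟩ : Opens d.Glued) ↦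
          (TotalSpace.mk' E_P x (s x.1) :
            TangentBundle 𝓘(ℝ, E_P) (⟨range d.inr, d.isOpen_range_inr⟩ : Opens d.Glued))) =
          fun x ↦ (TotalSpace.mk' E_P x (mpullback 𝓘(ℝ, E_P) I_B θ.symm τB.vectorField x) :
            TangentBundle 𝓘(ℝ, E_P) (⟨range d.inr, d.isOpen_range_inr⟩ : Opens d.Glued)) := by
        funext x
        have hx : (x : d.Glued) ∈ range d.inr := x.2
        simp only [s, dif_pos hx]
      rw [heq]
      exact hY ⟨p, hp⟩
    exact (OpenSubmanifold.contMDiffAt_tangentSection_of_restrict _ ⟨p, hp⟩ hrestr).contMDiffWithinAt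
  · have h : d.inr b ∈ range d.inr := ⟨b, rfl⟩
    have hx : (⟨d.inr b, h⟩ : (⟨range d.inr, d.isOpen_range_inr⟩ : Opens d.Glued)) = θ b :=
      Subtype.ext (hθ b).symm
    simp only [s, dif_pos h]
    rw [hx, d.mpullback_symm_apply' τB θ (θ b)]
    have hgen : ∀ b', b' = b → mfderiv I_B 𝓘(ℝ, E_P) θ b' (τB.vectorField b') =
        mfderiv I_B 𝓘(ℝ, E_P) d.inr b (τB.vectorField b) := by
      intro b' hb'
      subst b'
      exact (d.mfderiv_inr_eq_of_diffeomorph θ hθ b _).symm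
    exact hgen _ (θ.symm_apply_apply b)

/-! ### Existence of the glued time orientation -/

/-- **Time orientations descend to the open gluing** (Sbierski 2016, §3.3, proof of Thm. 5, time
orientation step). Let `g̃` be a Lorentzian metric on `A ∪_ψ B` for which `inl`, `inr` are
isometric immersions of the time-oriented `(A, g_A, T_A)`, `(B, g_B, T_B)`, and suppose that on
the gluing region the pushed-forward orienting vectors lie in one timecone,
`g̃(d(inl) T_A(a), d(inr) T_B(ψ a)) < 0` (this is where "`ψ` preserves the time orientation"
enters). If the glued space is Hausdorff, there is a time orientation `T̃` of `g̃` — a smooth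
timelike vector field — for which `d(inl) T_A` and `d(inr) T_B` are future-directed, i.e. `inl`
and `inr` preserve the time orientations. Construction: the future timecones
`t p = {v timelike | g̃(R p, v) < 0}` of the pushed-forward orienting vectors `R p` (of `A` on
`inl(A)`, of `B` elsewhere) are convex (`LorentzianMetric.convex_timecone`) and admit the smooth
local sections of `exists_contMDiffOn_pushforward_inl`/`inr` (the pushed-forward fields, which lie
in these cones by the compatibility hypothesis and the timecone lemma
`LorentzianMetric.val_lt_zero_of_isCausal`); a smooth global section in the cones exists by a
partition of unity (Mathlib's `exists_contMDiffSection_forall_mem_convex_of_local`; the glued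
space is σ-compact, being a second countable finite-dimensional manifold). [cite: Sbierski2016AHP, §3.3, proof of Thm. 5 ("`(M̃, g̃)` has a natural time orientation")] -/
theorem _root_.Literature.Topology.FourManifolds.SmoothGlueData.exists_timeOrientation_of_glue
    [FiniteDimensional ℝ E_P] [T2Space d.Glued] [SecondCountableTopology A] [SecondCountableTopology B] (g : LorentzianMetric 𝓘(ℝ, E_P) ∞ d.Glued)
    (hgA : ∀ (a : A) (v w : TangentSpace I_A a),
      g.val (d.inl a) (mfderiv I_A 𝓘(ℝ, E_P) d.inl a v) (mfderiv I_A 𝓘(ℝ, E_P) d.inl a w) =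
        gA.val a v w)
    (hgB : ∀ (b : B) (v w : TangentSpace I_B b),
      g.val (d.inr b) (mfderiv I_B 𝓘(ℝ, E_P) d.inr b v) (mfderiv I_B 𝓘(ℝ, E_P) d.inr b w) =
        gB.val b v w)
    (hcone : ∀ a (_ : a ∈ d.glue.source),
      g.val (d.inl a) (mfderiv I_A 𝓘(ℝ, E_P) d.inl a (τA.vectorField a))
        (mfderiv I_B 𝓘(ℝ, E_P) d.inr (d.glue a) (τB.vectorField (d.glue a))) < 0) :
    ∃ τ : TimeOrientation g,
      (∀ a, τ.IsFutureDirected (x := d.inl a)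
        (mfderiv I_A 𝓘(ℝ, E_P) d.inl a (τA.vectorField a))) ∧
      ∀ b, τ.IsFutureDirected (x := d.inr b)
        (mfderiv I_B 𝓘(ℝ, E_P) d.inr b (τB.vectorField b)) := by
  classical
  haveI : SecondCountableTopology d.Glued := d.secondCountableTopology_of_pieces
  haveI : LocallyCompactSpace d.Glued := ChartedSpace.locallyCompactSpace (H := E_P) (M := d.Glued)
  -- the pushed-forward orienting vectors
  set FA : A → E_P := fun a ↦ mfderiv I_A 𝓘(ℝ, E_P) d.inl a (τA.vectorField a) with hFA
  set FB : B → E_P := fun b ↦ mfderiv I_B 𝓘(ℝ, E_P) d.inr b (τB.vectorField b) with hFB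
  have hFAt : ∀ a, g.IsTimelike (x := d.inl a) (FA a) := fun a ↦ by
    change g.val (d.inl a) (FA a) (FA a) < 0
    rw [hFA, hgA]
    exact τA.isTimelike a
  have hFBt : ∀ b, g.IsTimelike (x := d.inr b) (FB b) := fun b ↦ by
    change g.val (d.inr b) (FB b) (FB b) < 0
    rw [hFB, hgB]
    exact τB.isTimelike b
  -- the cone compatibility at the points of `inr(B) ∩ inl(A)`, based at `inr b`
  have hcone' : ∀ (a : A) (b : B), d.inl a = d.inr b → g.val (d.inr b) (FA a) (FB b) < 0 := by
    intro a b hab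
    obtain ⟨ha, rfl⟩ := d.inl_eq_inr_iff.1 hab
    have hgen : ∀ p, p = d.inl a →
        g.val p (FA a) (FB (d.glue a)) < 0 := by
      rintro p rfl
      exact hcone a ha
    exact hgen _ hab.symm
  -- the reference vector at each point: `FA` on `inl(A)`, `FB` elsewhere
  let R : d.Glued → E_P := fun p ↦
    if h : ∃ a, d.inl a = p then FA h.choose
    else FB ((d.exists_inl_or_inr p).resolve_left h).choose
  have hR_inl : ∀ a, R (d.inl a) = FA a := fun a ↦ by
    have h : ∃ a', d.inl a' = d.inl a := ⟨a, rfl⟩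
    simp only [R, dif_pos h, d.inl_injective h.choose_spec]
  have hR_inr : ∀ b, (¬ ∃ a, d.inl a = d.inr b) → R (d.inr b) = FB b := fun b hb ↦ by
    simp only [R, dif_neg hb,
      d.inr_injective ((d.exists_inl_or_inr (d.inr b)).resolve_left hb).choose_spec]
  have hRt : ∀ p, g.IsTimelike (x := p) (R p) := fun p ↦ by
    by_cases h : ∃ a, d.inl a = p
    · obtain ⟨a, rfl⟩ := h
      rw [hR_inl]
      exact hFAt a
    · obtain ⟨b, rfl⟩ := (d.exists_inl_or_inr p).resolve_left h
      rw [hR_inr b h]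
      exact hFBt b
  -- at `inr b`, `FB b` lies in the cone of `R (inr b)`
  have hRFB : ∀ b, g.val (d.inr b) (R (d.inr b)) (FB b) < 0 := fun b ↦ by
    by_cases h : ∃ a, d.inl a = d.inr b
    · obtain ⟨a, ha⟩ := h
      have hR : R (d.inr b) = FA a := by rw [← ha, hR_inl]
      rw [hR]
      exact hcone' a b ha
    · rw [hR_inr b h]
      exact hFBt b
  -- the convex cone field
  let t : ∀ p : d.Glued, Set (TangentSpace 𝓘(ℝ, E_P) p) := fun p ↦
    {v | g.IsTimelike v ∧ g.val p (R p) v < 0}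
  have ht_conv : ∀ p, Convex ℝ (t p) := fun p ↦ g.convex_timecone (hRt p)
  -- local sections: the pushed-forward fields
  obtain ⟨sA, hsA, hsAval⟩ := d.exists_contMDiffOn_pushforward_inl τA
  obtain ⟨sB, hsB, hsBval⟩ := d.exists_contMDiffOn_pushforward_inr τB
  have Hloc : ∀ p₀ : d.Glued, ∃ U ∈ 𝓝 p₀, ∃ s : Π p : d.Glued, TangentSpace 𝓘(ℝ, E_P) p,
      ContMDiffOn 𝓘(ℝ, E_P) 𝓘(ℝ, E_P).tangent ∞
        (fun p ↦ (TotalSpace.mk' E_P p (s p) : TangentBundle 𝓘(ℝ, E_P) d.Glued)) U ∧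
        ∀ p ∈ U, s p ∈ t p := by
    intro p₀
    obtain (⟨a₀, rfl⟩ | ⟨b₀, rfl⟩) := d.exists_inl_or_inr p₀
    · refine ⟨range d.inl, d.isOpen_range_inl.mem_nhds ⟨a₀, rfl⟩, sA, hsA, ?_⟩
      rintro _ ⟨a, rfl⟩
      rw [mem_setOf_eq, hsAval a, hR_inl]
      exact ⟨hFAt a, hFAt a⟩
    · refine ⟨range d.inr, d.isOpen_range_inr.mem_nhds ⟨b₀, rfl⟩, sB, hsB, ?_⟩
      rintro _ ⟨b, rfl⟩
      rw [mem_setOf_eq, hsBval b]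
      exact ⟨hFBt b, hRFB b⟩
  obtain ⟨s, hs⟩ := exists_contMDiffSection_forall_mem_convex_of_local (n := (⊤ : ℕ∞)) 𝓘(ℝ, E_P)
    (TangentSpace 𝓘(ℝ, E_P) : d.Glued → Type _) t ht_conv Hloc
  refine ⟨⟨s, fun p ↦ (hs p).1, s.contMDiff⟩, fun a ↦ ?_, fun b ↦ ?_⟩
  · -- `d(inl) T_A` is future-directed: `g̃(s, FA) = g̃(R, s) < 0` at `inl a`
    refine ⟨(hFAt a).isCausal, ?_⟩
    have h := (hs (d.inl a)).2
    rw [hR_inl] at h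
    change g.val (d.inl a) (s (d.inl a)) (FA a) < 0
    rwa [g.symm]
  · refine ⟨(hFBt b).isCausal, ?_⟩
    change g.val (d.inr b) (s (d.inr b)) (FB b) < 0
    -- the timecone lemma: `s` and `FB b` both lie in the cone of `R (inr b)`
    exact g.val_lt_zero_of_isCausal (hRt (d.inr b)) (hs (d.inr b)).1 (hs (d.inr b)).2
      (hFBt b).isCausal (hRFB b)

end TimeOrientation

end GlueData

end Literature.Geometry.Lorentzian

end
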